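import Literature.Probability.Percolation.AdjFourArmCyclic
import HarnessLib

/-!
# Rerouted arm families keep the adjacent cyclic pattern: the order certificate by chords

Topic `Literature/Probability/Percolation`; family `crit-perc` (planar combinatorics of site
percolation on `𝕋`). A brick of the near-critical arm-separation theorem for four arms in the
ADJACENT colour arrangement (P. Nolin, *Near-critical percolation in two dimensions*, EJP 13
(2008), Thm. 11 for `j = 4`, `σ = BBWW` [arXiv 0711.4948: Thm. 10]), the last missing input of the
tree's proof of Werner's Lemma 6.3 for the order-free `π̂_t`
(`Werner2009_lemma63_of_altSeparation_of_adjSeparation`). Every step of that proof REROUTES the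
arms near their tips (Nolin 2008, §4.4, proof of Lemma 15 [arXiv Lemma 14]: "replace the tip of
each `c'_v` by the tip of one of the `c_u`'s"), and the landed event must record the colour
arrangement of the NEW tips (`adjFourArmCyc`, `AdjFourArmCyclic.lean`: the closed tips do not
separate the open ones on `∂Λ_R`). For alternating colours the tree certifies the new order by the
cluster structure (`AnnulusAlternationBlocks.lean`); for the adjacent arrangement two consecutive
arms have the same colour and may lie in the same cluster, so a different certificate is needed.
This file provides it, from the disc lemma alone (`not_hexSep_of_paths`, Bollobás–Riordan 2006,
Ch. 7 Lemma 5): **if each old tip is joined to its new tip by a connected set of its own colour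
("chord"), the open chords avoiding the closed arms and the closed chords avoiding the new open
arms, then the new tips are cyclically adjacent as soon as the old ones are.** The circle
combinatorics is the transitivity of "`{p, q}` does not separate `{a, ·}`" (an equivalence with two
classes); each non-separation fact is one instance of the disc lemma (the two closed old tips are
joined through the hole by the closed arms, the two new open tips through the hole by the new open
arms).

* `not_hexSep_trans` — `¬ {p,q} sep {a,b}` and `¬ {p,q} sep {b,c}` give `¬ {p,q} sep {a,c}`;
* `not_hexSep_symm'` — symmetry of non-separation for four distinct points;
* `adjacent_pattern_transfer` — the certificate.

Everything here is proved; no named facts are introduced.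

## References

* P. Nolin, Near-critical percolation in two dimensions, *Electron. J. Probab.* 13 (2008), §4.1
  (colour sequences in counterclockwise order), §4.4 proof of Lemma 15 (arXiv 0711.4948: Lemma 14)
  [Nolin2008].
* B. Bollobás, O. Riordan, *Percolation*, Cambridge University Press (2006), Ch. 7, Lemma 5
  p. 169 [BollobasRiordan2006].

Tree: `HexSep`, `HexBtw`, `hexSep_symm`, `not_hexSep_of_paths`, `hexPos`, `hexPos_injOn`
(`AdjFourArmCyclic.lean`, `TriBallDisc.lean`); `PathIn`.
-/

noncomputable section

open Set

namespace Literature.Probability.Percolation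

open LatticeModels

/-- **Non-separation by a fixed pair is transitive**: if `{p, q}` separates neither `{a, b}` nor
`{b, c}` then it does not separate `{a, c}` ("same arc of the circle cut at `p`, `q`" is an
equivalence relation). [folklore] -/
theorem not_hexSep_trans {p q a b c : ℤ} (h₁ : ¬ HexSep p q a b) (h₂ : ¬ HexSep p q b c) : ¬ HexSep p q a c := by
  unfold HexSep at h₁ h₂ ⊢; tauto

/-- Symmetry of NON-separation for four distinct points. [folklore] -/
theorem not_hexSep_symm' {a b c d : ℤ} (hac : a ≠ c) (had : a ≠ d) (hbc : b ≠ c) (hbd : b ≠ d)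
    (h : ¬ HexSep a b c d) : ¬ HexSep c d a b :=
  fun h' => h (hexSep_symm hac.symm hbc.symm had.symm hbd.symm h')

/-- **The order certificate.** On `∂Λ_R` (`R ≥ 1`) let `w₁, w₂` be the old open tips, `y₃, y₄` the
old closed tips, `z₁, z₂` the new open tips and `z₃, z₄` the new closed tips, with the old pattern
adjacent (`{y₃, y₄}` does not separate `{w₁, w₂}`). Suppose: the old and new open tips of each open
arm are joined inside `Λ_R` by a path of a set `B₁` (resp. `B₂`) off which the two old CLOSED tips
are joined inside `Λ_R` (by the closed arms through the hole); and the old and new closed tips of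
each closed arm are joined by a path of a set `B₃` (resp. `B₄`) off which the two new OPEN tips are
joined (by the new open arms through the hole). Then the new pattern is adjacent: `{z₃, z₄}` does
not separate `{z₁, z₂}`. [cite: Nolin2008, §4.1 and §4.4 proof of Lemma 15 (arXiv 0711.4948: Lemma 14), σ = BBWW] [cite: BollobasRiordan2006, Ch. 7 Lemma 5 p. 169] -/
theorem adjacent_pattern_transfer {R : ℕ} (hR : 1 ≤ R) {w₁ w₂ y₃ y₄ z₁ z₂ z₃ z₄ : Site 2}
    (hw₁ : triNorm w₁ = R) (hw₂ : triNorm w₂ = R) (hy₃ : triNorm y₃ = R) (hy₄ : triNorm y₄ = R)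
    (hz₁ : triNorm z₁ = R) (hz₂ : triNorm z₂ = R) (hz₃ : triNorm z₃ = R) (hz₄ : triNorm z₄ = R)
    (h13 : z₁ ≠ y₃) (h14 : z₁ ≠ y₄) (h23 : z₂ ≠ y₃) (h24 : z₂ ≠ y₄)
    (h13' : z₁ ≠ z₃) (h14' : z₁ ≠ z₄) (h23' : z₂ ≠ z₃) (h24' : z₂ ≠ z₄)
    (h0 : ¬ HexSep (hexPos R y₃) (hexPos R y₄) (hexPos R w₁) (hexPos R w₂))
    (B₁ B₂ B₃ B₄ : Set (Site 2))
    (h1 : PathIn triGraph ((↑(triBall R) : Set (Site 2)) ∩ B₁) w₁ z₁)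
    (h1' : PathIn triGraph ((↑(triBall R) : Set (Site 2)) ∩ B₁ᶜ) y₃ y₄)
    (h2 : PathIn triGraph ((↑(triBall R) : Set (Site 2)) ∩ B₂) w₂ z₂)
    (h2' : PathIn triGraph ((↑(triBall R) : Set (Site 2)) ∩ B₂ᶜ) y₃ y₄)
    (h3 : PathIn triGraph ((↑(triBall R) : Set (Site 2)) ∩ B₃) y₃ z₃)
    (h3' : PathIn triGraph ((↑(triBall R) : Set (Site 2)) ∩ B₃ᶜ) z₁ z₂)
    (h4 : PathIn triGraph ((↑(triBall R) : Set (Site 2)) ∩ B₄) y₄ z₄)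
    (h4' : PathIn triGraph ((↑(triBall R) : Set (Site 2)) ∩ B₄ᶜ) z₁ z₂) :
    ¬ HexSep (hexPos R z₃) (hexPos R z₄) (hexPos R z₁) (hexPos R z₂) := by
  -- `{y₃, y₄}` separates none of `{w₁, z₁}`, `{w₁, w₂}`, `{w₂, z₂}`, hence not `{z₁, z₂}`
  have i1 : ¬ HexSep (hexPos R y₃) (hexPos R y₄) (hexPos R w₁) (hexPos R z₁) := not_hexSep_of_paths hR B₁ hw₁ hy₃ hz₁ hy₄ h1 h1'
  have i2 : ¬ HexSep (hexPos R y₃) (hexPos R y₄) (hexPos R w₂) (hexPos R z₂) := not_hexSep_of_paths hR B₂ hw₂ hy₃ hz₂ hy₄ h2 h2'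
  have i1s : ¬ HexSep (hexPos R y₃) (hexPos R y₄) (hexPos R z₁) (hexPos R w₁) := fun h => i1 (hexSep_comm_right h)
  have t12 : ¬ HexSep (hexPos R y₃) (hexPos R y₄) (hexPos R z₁) (hexPos R z₂) :=
    not_hexSep_trans (not_hexSep_trans i1s h0) i2
  -- read from `{z₁, z₂}`: it separates none of `{y₃, y₄}`, `{y₃, z₃}`, `{y₄, z₄}`
  have n13 : hexPos R z₁ ≠ hexPos R y₃ := fun e => h13 (hexPos_injOn hR hz₁ hy₃ e)
  have n14 : hexPos R z₁ ≠ hexPos R y₄ := fun e => h14 (hexPos_injOn hR hz₁ hy₄ e)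
  have n23 : hexPos R z₂ ≠ hexPos R y₃ := fun e => h23 (hexPos_injOn hR hz₂ hy₃ e)
  have n24 : hexPos R z₂ ≠ hexPos R y₄ := fun e => h24 (hexPos_injOn hR hz₂ hy₄ e)
  have n13' : hexPos R z₁ ≠ hexPos R z₃ := fun e => h13' (hexPos_injOn hR hz₁ hz₃ e)
  have n14' : hexPos R z₁ ≠ hexPos R z₄ := fun e => h14' (hexPos_injOn hR hz₁ hz₄ e)
  have n23' : hexPos R z₂ ≠ hexPos R z₃ := fun e => h23' (hexPos_injOn hR hz₂ hz₃ e)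
  have n24' : hexPos R z₂ ≠ hexPos R z₄ := fun e => h24' (hexPos_injOn hR hz₂ hz₄ e)
  have s34 : ¬ HexSep (hexPos R z₁) (hexPos R z₂) (hexPos R y₃) (hexPos R y₄) :=
    not_hexSep_symm' n13.symm n23.symm n14.symm n24.symm t12
  have i3 : ¬ HexSep (hexPos R z₁) (hexPos R z₂) (hexPos R y₃) (hexPos R z₃) := not_hexSep_of_paths hR B₃ hy₃ hz₁ hz₃ hz₂ h3 h3'
  have i4 : ¬ HexSep (hexPos R z₁) (hexPos R z₂) (hexPos R y₄) (hexPos R z₄) := not_hexSep_of_paths hR B₄ hy₄ hz₁ hz₄ hz₂ h4 h4'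
  have i3s : ¬ HexSep (hexPos R z₁) (hexPos R z₂) (hexPos R z₃) (hexPos R y₃) := fun h => i3 (hexSep_comm_right h)
  have t34 : ¬ HexSep (hexPos R z₁) (hexPos R z₂) (hexPos R z₃) (hexPos R z₄) :=
    not_hexSep_trans (not_hexSep_trans i3s s34) i4
  exact not_hexSep_symm' n13' n14' n23' n24' t34

end Literature.Probability.Percolation
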